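import Summits.Ventures.WeilGRH.CensusTwoPrimeRungs
import Summits.Ventures.WeilGRH.ThirdPrimeReflectionRungs
import Summits.Ventures.WeilGRH.FrontierTrivialAtTwo
import HarnessLib

/-!
# GRH arm (rh-explicit, venture WeilGRH): named census cells from weil-grh-2's THIRD-PRIME and FRONTIER rungs
  (part 3: `χ(2) = 1` — 15.14, 17.16 — and the even modulus 20)

Cell `rh-explicit`, WEIL TRACK — GRH ARM (census / typing seat weil-grh-1).  Sequel of `CensusTwoPrimeRungs{,2}.lean`.
weil-grh-2's `ThirdPrimeReflectionRungs.lean` (reflect `3`, crude `2`) and `FrontierTrivialAtTwo.lean` (the ζ frontier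
`4023/5000` transferred to characters trivial at `2`) carry the hypotheses `χ(2) = 1` (and `χ(3) = −1`); here they
are discharged from the census table for the NAMED characters

| cell | facts | rung(s) | via |
|---|---|---|---|
| 15.14 = `(−15/·)` | `χ(2) = 1` | 59/100 | `…_fiftynine_of_trivial_at_two` (`q ≥ 12`) |
| 17.16 = `(17/·)` | `χ(2) = 1`, `χ(3) = −1` | 59/100, log 2, **4023/5000** (ζ frontier) | `…_of_trivial_at_two`, `…_log_two_of_trivial_at_two_quadratic_at_three` (`q ≥ 13`), `…_frontier_of_trivial_at_two_quadratic_at_three` (`q ≥ 16`) |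
| 20.3 / 20.7 | modulus `20` even, `≥ 20` | 59/100 | `…_fiftynine_of_even_ge_20` |

No new definitions; no named facts; RH/GRH-free.
-/

noncomputable section

open Complex
open scoped Real ComplexConjugate

namespace Summit.Ventures.WeilGRH

open Literature.NumberTheory.LFunctions

/-- `(2 : ZMod q)` is the cast of the natural number `2`. -/
private theorem two_eq_natCast₃ (q : ℕ) : (2 : ZMod q) = ((2 : ℕ) : ZMod q) := by norm_cast

/-- `(3 : ZMod q)` is the cast of the natural number `3`. -/
private theorem three_eq_natCast₃ (q : ℕ) : (3 : ZMod q) = ((3 : ℕ) : ZMod q) := by norm_cast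

/-! ## 15.14: `χ(2) = 1` -/

/-- `χ_{15.14}(2) = 1`. -/
theorem census_15_14_two : (censusRow 15 14).toChar (census20_check _ (by decide)) (2 : ZMod _) = 1 := by
  rw [two_eq_natCast₃, ConreyRow.toChar_apply_natCast, if_pos (by decide),
    show (censusRow 15 14).e 2 = 0 by decide, pow_zero]

/-- **Cell 15.14 at `59/100`** (χ_{15.14} = `(−15/·)`, odd, `χ(2) = 1`). -/
theorem weilPositivityOnChar_fiftynine_census_15_14 :
    WeilPositivityOnChar ((censusRow 15 14).toChar (census20_check _ (by decide))) (59 / 100) :=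
  weilPositivityOnChar_fiftynine_of_trivial_at_two (by decide) _ census_15_14_two

/-! ## 17.16: `χ(2) = 1`, `χ(3) = −1` — up to the ζ FRONTIER `4023/5000` -/

/-- `χ_{17.16}(2) = 1`. -/
theorem census_17_16_two : (censusRow 17 16).toChar (census20_check _ (by decide)) (2 : ZMod _) = 1 := by
  rw [two_eq_natCast₃, ConreyRow.toChar_apply_natCast, if_pos (by decide),
    show (censusRow 17 16).e 2 = 0 by decide, pow_zero]

/-- `χ_{17.16}(3) = −1`. -/
theorem census_17_16_three : (censusRow 17 16).toChar (census20_check _ (by decide)) (3 : ZMod _) = -1 := by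
  rw [three_eq_natCast₃, ConreyRow.toChar_apply_natCast, if_pos (by decide), ConreyRow.zeta_pow_eq_cexp,
    show (censusRow 17 16).e 3 = 1 by decide, show (censusRow 17 16).ord = 2 by decide,
    show (2 * π * ((1 : ℕ) : ℝ) / ((2 : ℕ) : ℝ) : ℝ) = π by push_cast; ring]
  exact cexp_pi_mul_I'

/-- **Cell 17.16 at `59/100`** (χ_{17.16} = `(17/·)`, even, `χ(2) = 1`). -/
theorem weilPositivityOnChar_fiftynine_census_17_16 :
    WeilPositivityOnChar ((censusRow 17 16).toChar (census20_check _ (by decide))) (59 / 100) :=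
  weilPositivityOnChar_fiftynine_of_trivial_at_two (by decide) _ census_17_16_two

/-- **Cell 17.16 at `log 2`** (`χ(2) = 1`, `χ(3) = −1`, `q = 17 ≥ 13`). -/
theorem weilPositivityOnChar_log_two_census_17_16 :
    WeilPositivityOnChar ((censusRow 17 16).toChar (census20_check _ (by decide))) (Real.log 2) :=
  weilPositivityOnChar_log_two_of_trivial_at_two_quadratic_at_three (by decide) _ census_17_16_two
    census_17_16_three

/-- **Cell 17.16 at the ζ FRONTIER `4023/5000`** (`χ(2) = 1`, `χ(3) = −1`, `q = 17 ≥ 16`): the highest rung of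
record for a named census character. -/
theorem weilPositivityOnChar_frontier_census_17_16 :
    WeilPositivityOnChar ((censusRow 17 16).toChar (census20_check _ (by decide))) (4023 / 5000) :=
  weilPositivityOnChar_frontier_of_trivial_at_two_quadratic_at_three (by decide) _ census_17_16_two
    census_17_16_three

/-! ## 20.3 / 20.7: even modulus `20` -/

/-- **Cell 20.3 at `59/100`** (modulus `20`, even). -/
theorem weilPositivityOnChar_fiftynine_census_20_3 :
    WeilPositivityOnChar ((censusRow 20 3).toChar (census20_check _ (by decide))) (59 / 100) :=
  weilPositivityOnChar_fiftynine_of_even_ge_20 (by decide) (by decide) _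

/-- **Cell 20.7 at `59/100`** (modulus `20`, even). -/
theorem weilPositivityOnChar_fiftynine_census_20_7 :
    WeilPositivityOnChar ((censusRow 20 7).toChar (census20_check _ (by decide))) (59 / 100) :=
  weilPositivityOnChar_fiftynine_of_even_ge_20 (by decide) (by decide) _

end Summit.Ventures.WeilGRH

end
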